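import Summits.Ventures.PercRepro.S1SpreadSeriesChain
import Summits.Ventures.PercRepro.S1CoreCapSpreadChainSixCircuits

/-!
# PercRepro — SERIES CLASSES IN THE SPREAD CHAIN, PART D: THE SERIES-AWARE `s₆` CHAIN `gSix` (p1, gen 35)

`proofs/P1-S2-CORANK6.md` §4q addendum 2. The series-aware step for the six-circuits: a point with `≥ 6` series partners lies on no
six-circuit, one with `4` or `5` on at most one (two such circuits share `x` and four partners; eliminating `x` leaves a circuit of size
`≤ 2` avoiding the partners), the averaging `deg ≤ 6·s₆/m` covers `k ≤ 3` (`ncard_sixCircuits_le_max_of_series`: `s₆ ≤ max Call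
(max (1 + C₆) ⌊m·C₄/(m − 6)⌋)` with the caps on coloop-free nullity-`d` cores on `≤ m − 7` / `m − 6 … m − 5` / `m − 4 … m − 1` points).
The per-point table is the trivial `C(j + 4, 5)` (`ncard_sixCircuitsThrough_le_choose`), so the no-point-count cap is
`bSix j = Σ_{i ≤ j} C(i + 4, 5) = C(j + 5, 6)` (`0, 1, 7, 28, 84, 210, 462, 924, 1716, …` — the `comb(d + 5, 6)` of S2's pricers);
THE CHAIN `gSix j m` (the cap at `j ≤ 4`, the step from `j = 5`) and **`ncard_sixCircuits_le_gSix`**. VALUES (`decide`):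
`gSix 6 19 = 204` (trivial `462`, the plain averaging `306`), `gSix 7 20 = 382` (`924` / `660`), `gSix 8 21 = 737` (`1716` / `1293`),
`gSix 6 18 = 220`, `gSix 7 19 = 447`, `gSix 8 20 = 840`. Nothing about any cell is claimed. Axioms: standard.
-/

open scoped Matroid

namespace PercRepro

namespace S1

open Set

open FourCap

variable {α : Type}

/-- **A point with `≥ 6` series partners lies on no six-circuit.** -/
theorem ncard_sixCircuitsThrough_eq_zero_of_six_le_coloops_delete (M : Matroid α) [M.Finite]
    (hK : ∀ e, ¬ M.IsColoop e) {x : α} (h6 : 6 ≤ (M ＼ {x}).coloops.ncard) :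
    {C : Set α | M.IsCircuit C ∧ C.ncard = 6 ∧ x ∈ C}.ncard = 0 := by
  rw [ncard_eq_zero (M.ground_finite.finite_subsets.subset (fun C hC => hC.1.subset_ground))]
  ext C
  simp only [mem_setOf_eq, mem_empty_iff_false, iff_false, not_and]
  intro hC h6' hxC
  have hsub : insert x (M ＼ {x}).coloops ⊆ C := by
    intro z hz
    rcases mem_insert_iff.1 hz with rfl | hz
    · exact hxC
    · exact mem_of_isColoop_delete_of_isCircuit M hK (Matroid.isColoop_iff_mem_coloops.2 hz) hC hxC
  have hfin : (M ＼ {x}).coloops.Finite := M.ground_finite.subset ((coloops_delete_subset M x).trans sdiff_subset)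
  have hx : x ∉ (M ＼ {x}).coloops := fun h => (coloops_delete_subset M x h).2 (mem_singleton x)
  have h7 : 7 ≤ (insert x (M ＼ {x}).coloops).ncard := by
    rw [ncard_insert_of_notMem hx hfin]; omega
  have := ncard_le_ncard hsub (M.ground_finite.subset hC.subset_ground)
  omega

/-- **A point with `4` or more series partners lies on at most one six-circuit.** -/
theorem ncard_sixCircuitsThrough_le_one_of_four_le_coloops_delete (M : Matroid α) [M.Finite]
    (hfree : ∀ e ∈ M.E, ∃ A ⊆ M.E \ {e}, e ∉ M.closure A ∧ e ∉ M.closure ((M.E \ {e}) \ A))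
    (hK : ∀ e, ¬ M.IsColoop e) {x : α} (h4 : 4 ≤ (M ＼ {x}).coloops.ncard) :
    {C : Set α | M.IsCircuit C ∧ C.ncard = 6 ∧ x ∈ C}.ncard ≤ 1 := by
  classical
  have hfin : (M ＼ {x}).coloops.Finite := M.ground_finite.subset ((coloops_delete_subset M x).trans sdiff_subset)
  obtain ⟨T, hTsub, hT4⟩ := Set.exists_subset_card_eq (s := (M ＼ {x}).coloops) (n := 4) h4
  have hTf : T.Finite := hfin.subset hTsub
  rw [ncard_le_one_iff (M.ground_finite.finite_subsets.subset (fun C hC => hC.1.subset_ground))]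
  intro C C' hC hC'
  by_contra hCC'
  obtain ⟨hC, hC6, hxC⟩ := hC
  obtain ⟨hC', hC'6, hxC'⟩ := hC'
  have hxE : x ∈ M.E := hC.subset_ground hxC
  have hTC : T ⊆ C := fun y hy =>
    mem_of_isColoop_delete_of_isCircuit M hK (Matroid.isColoop_iff_mem_coloops.2 (hTsub hy)) hC hxC
  have hTC' : T ⊆ C' := fun y hy =>
    mem_of_isColoop_delete_of_isCircuit M hK (Matroid.isColoop_iff_mem_coloops.2 (hTsub hy)) hC' hxC'
  have hxT : x ∉ T := fun h => (coloops_delete_subset M x (hTsub h)).2 (mem_singleton x)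
  -- eliminate `x`
  obtain ⟨D, hDsub, hD⟩ := hC.elimination hC' hCC' x
  have hD3 := three_le_ncard_of_isCircuit_of_hfree M hfree hD
  have hxD : x ∉ D := fun h => (hDsub h).2 (mem_singleton x)
  have hTD : ∀ y ∈ T, y ∉ D := fun y hy h =>
    hxD (mem_of_isColoop_delete_of_isCircuit M hK
      (isColoop_delete_symm M hK hxE (Matroid.isColoop_iff_mem_coloops.2 (hTsub hy))) hD h)
  have hDsub' : D ⊆ (C ∪ C') \ insert x T := by
    intro z hz
    refine ⟨(hDsub hz).1, ?_⟩
    simp only [mem_insert_iff, not_or]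
    exact ⟨fun h => hxD (h ▸ hz), fun h => hTD z h hz⟩
  have hCf : C.Finite := M.ground_finite.subset hC.subset_ground
  have hC'f : C'.Finite := M.ground_finite.subset hC'.subset_ground
  have hsub4 : insert x T ⊆ C ∩ C' := by
    intro z hz
    rcases mem_insert_iff.1 hz with rfl | hz
    · exact ⟨hxC, hxC'⟩
    · exact ⟨hTC hz, hTC' hz⟩
  have h5 : (insert x T).ncard = 5 := by rw [ncard_insert_of_notMem hxT hTf, hT4]
  have hinter : 5 ≤ (C ∩ C').ncard := h5 ▸ ncard_le_ncard hsub4 (hCf.subset inter_subset_left)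
  have hunion : (C ∪ C').ncard ≤ 7 := by
    have := Set.ncard_union_add_ncard_inter C C' hCf hC'f
    omega
  have hdiff : ((C ∪ C') \ insert x T).ncard ≤ 2 := by
    have h := Set.ncard_sdiff (show insert x T ⊆ C ∪ C' from (hsub4.trans inter_subset_left).trans subset_union_left)
      (hTf.insert x)
    rw [h, h5]
    omega
  have := ncard_le_ncard hDsub' ((hCf.union hC'f).subset sdiff_subset)
  omega

/-- **Deleting the coloops keeps the six-circuits.** -/
theorem sixCircuits_delete_coloops_eq (N : Matroid α) :
    {C : Set α | (N ＼ N.coloops).IsCircuit C ∧ C.ncard = 6} = {C : Set α | N.IsCircuit C ∧ C.ncard = 6} := by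
  ext C
  simp only [mem_setOf_eq, Matroid.delete_isCircuit_iff]
  constructor
  · rintro ⟨⟨hC, -⟩, h6⟩; exact ⟨hC, h6⟩
  · rintro ⟨hC, h6⟩; exact ⟨⟨hC, hC.disjoint_coloops⟩, h6⟩

/-- **THE SERIES-AWARE STEP FOR `s₆`** (see the module docstring). -/
theorem ncard_sixCircuits_le_max_of_series (M : Matroid α) [M.Finite]
    (hfree : ∀ e ∈ M.E, ∃ A ⊆ M.E \ {e}, e ∉ M.closure A ∧ e ∉ M.closure ((M.E \ {e}) \ A))
    (hns : ¬ ∃ W ⊆ M.E, W.ncard ≤ 9 ∧ W.encard = M.eRk W + 4)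
    {d : ℕ} (hd : M.E.encard = M.eRank + (d + 1)) {m : ℕ} (hm : M.E.ncard = m) (hm6 : 6 < m)
    (hK : ∀ e, ¬ M.IsColoop e) {Call C₆ C₄ : ℕ}
    (hall : ∀ (M' : Matroid α) [M'.Finite],
      (∀ e ∈ M'.E, ∃ A ⊆ M'.E \ {e}, e ∉ M'.closure A ∧ e ∉ M'.closure ((M'.E \ {e}) \ A)) →
      (¬ ∃ W ⊆ M'.E, W.ncard ≤ 9 ∧ W.encard = M'.eRk W + 4) → M'.E.encard = M'.eRank + d →
      M'.E.ncard ≤ m - 7 → (∀ e, ¬ M'.IsColoop e) → {C : Set α | M'.IsCircuit C ∧ C.ncard = 6}.ncard ≤ Call)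
    (h6 : ∀ (M' : Matroid α) [M'.Finite],
      (∀ e ∈ M'.E, ∃ A ⊆ M'.E \ {e}, e ∉ M'.closure A ∧ e ∉ M'.closure ((M'.E \ {e}) \ A)) →
      (¬ ∃ W ⊆ M'.E, W.ncard ≤ 9 ∧ W.encard = M'.eRk W + 4) → M'.E.encard = M'.eRank + d →
      m - 6 ≤ M'.E.ncard → M'.E.ncard ≤ m - 5 → (∀ e, ¬ M'.IsColoop e) →
      {C : Set α | M'.IsCircuit C ∧ C.ncard = 6}.ncard ≤ C₆)
    (h4 : ∀ (M' : Matroid α) [M'.Finite],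
      (∀ e ∈ M'.E, ∃ A ⊆ M'.E \ {e}, e ∉ M'.closure A ∧ e ∉ M'.closure ((M'.E \ {e}) \ A)) →
      (¬ ∃ W ⊆ M'.E, W.ncard ≤ 9 ∧ W.encard = M'.eRk W + 4) → M'.E.encard = M'.eRank + d →
      m - 4 ≤ M'.E.ncard → M'.E.ncard ≤ m - 1 → (∀ e, ¬ M'.IsColoop e) →
      {C : Set α | M'.IsCircuit C ∧ C.ncard = 6}.ncard ≤ C₄) :
    {C : Set α | M.IsCircuit C ∧ C.ncard = 6}.ncard ≤ max Call (max (1 + C₆) (m * C₄ / (m - 6))) := by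
  classical
  set s := {C : Set α | M.IsCircuit C ∧ C.ncard = 6}.ncard with hs
  rcases Nat.eq_zero_or_pos s with h0 | hpos
  · rw [h0]; exact Nat.zero_le _
  obtain ⟨x, hxE, hxc, hx⟩ := exists_nonColoop_ncard_sixCircuitsThrough_le M hpos
  rw [← hs] at hx
  have hfilt : (M.ground_finite.toFinset.filter (fun x => ¬ M.IsColoop x)).card = m := by
    rw [Finset.filter_true_of_mem (fun x _ => hK x), ← ncard_eq_toFinset_card _ M.ground_finite, hm]
  rw [hfilt] at hx
  set N := M ＼ {x} with hN
  set K := N.coloops with hKdef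
  set M' := N ＼ K with hM'
  have hKsub : K ⊆ M.E \ {x} := coloops_delete_subset M x
  have hKfin : K.Finite := M.ground_finite.subset (hKsub.trans sdiff_subset)
  have hdN : N.E.encard = N.eRank + d := nullity_delete_singleton_of_not_isColoop M hxE hxc hd
  have hdM' : M'.E.encard = M'.eRank + d := nullity_delete_coloops N hdN
  have hfree' := S1.hfree_delete_set N (S1.hfree_delete M hfree x) K
  have hns' := spread_delete_set N (spread_delete M hns x) K
  have hK' : ∀ e, ¬ M'.IsColoop e := fun e => not_isColoop_delete_coloops N e
  have hnM' : M'.E.ncard = m - 1 - K.ncard := by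
    have h1 : N.E = M.E \ {x} := Matroid.delete_ground M {x}
    have h2 : M'.E = N.E \ K := Matroid.delete_ground N K
    rw [h2, Set.ncard_sdiff (by rw [h1]; exact hKsub) hKfin, h1, ncard_sdiff_singleton_of_mem hxE, hm]
  have hsplit := ncard_sixCircuits_le_through_add_delete M x
  have hsame : {C : Set α | N.IsCircuit C ∧ C.ncard = 6}.ncard = {C : Set α | M'.IsCircuit C ∧ C.ncard = 6}.ncard := by
    rw [hM', sixCircuits_delete_coloops_eq N]
  rw [← hs, hsame] at hsplit
  rcases Nat.lt_or_ge K.ncard 4 with hk3 | hk4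
  · -- `k ≤ 3`: the averaging
    have hb := h4 M' hfree' hns' hdM' (by omega) (by omega) hK'
    have hsub : s - 6 * s / m ≤ C₄ := by omega
    exact (le_mul_div_of_sub_div_le_six hm6 hsub).trans (le_max_of_le_right (le_max_right _ _))
  rcases Nat.lt_or_ge K.ncard 6 with hk5 | hk6
  · -- `k ∈ {4, 5}`
    have hdeg := ncard_sixCircuitsThrough_le_one_of_four_le_coloops_delete M hfree hK (x := x) hk4
    have hb := h6 M' hfree' hns' hdM' (by omega) (by omega) hK'
    have : s ≤ 1 + C₆ := by omega
    exact this.trans (le_max_of_le_right (le_max_left _ _))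
  · -- `k ≥ 6`
    have hdeg := ncard_sixCircuitsThrough_eq_zero_of_six_le_coloops_delete M hK (x := x) hk6
    have hb := hall M' hfree' hns' hdM' (by omega) hK'
    have : s ≤ Call := by omega
    exact this.trans (le_max_left _ _)

/-- The per-point six-circuit table: the trivial `C(j + 4, 5)` at every nullity. -/
def qSixAll (j : ℕ) : ℕ := (j + 4).choose 5

/-- **The no-point-count spread `s₆` cap at every nullity**: `s₆ ≤ capSum qSixAll j` (`= C(j + 5, 6)`). -/
theorem ncard_sixCircuits_le_capSum_qSixAll (M : Matroid α) [M.Finite]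
    (hfree : ∀ e ∈ M.E, ∃ A ⊆ M.E \ {e}, e ∉ M.closure A ∧ e ∉ M.closure ((M.E \ {e}) \ A))
    (hns : ¬ ∃ W ⊆ M.E, W.ncard ≤ 9 ∧ W.encard = M.eRk W + 4) {j : ℕ} (hd : M.E.encard = M.eRank + j) :
    {C : Set α | M.IsCircuit C ∧ C.ncard = 6}.ncard ≤ capSum qSixAll j :=
  ncard_sixCircuits_le_capSum_spread_of M hfree hns hd qSixAll
    (fun M' _ _ _ _ hi e _ => ncard_sixCircuitsThrough_le_choose M' hi e)

/-- The no-point-count `s₆` chain `bSix j = Σ_{i ≤ j} C(i + 4, 5) = C(j + 5, 6)` (`0, 1, 7, 28, 84, 210, 462, 924, 1716, …`). -/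
def bSix (j : ℕ) : ℕ := capSum qSixAll j

/-- **THE SERIES-AWARE SPREAD `s₆` CHAIN**: the no-point-count cap at `j ≤ 4`, the series-aware step from `j = 5`. -/
def gSix : ℕ → ℕ → ℕ
  | 0, _ => 0
  | j + 1, m =>
    if j + 1 ≤ 4 then bSix (j + 1)
    else min (bSix (j + 1)) (max ((Finset.Icc (j + 6) (m - 7)).sup (gSix j))
      (max (1 + (Finset.Icc (max (j + 6) (m - 6)) (m - 5)).sup (gSix j))
        (m * (Finset.Icc (max (j + 6) (m - 4)) (m - 1)).sup (gSix j) / (m - 6))))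

/-- **`s₆ ≤ gSix j m` on every coloop-free spread e-free core of nullity `j` on `m` points.** -/
theorem ncard_sixCircuits_le_gSix (j : ℕ) : ∀ (M : Matroid α) [M.Finite],
    (∀ e ∈ M.E, ∃ A ⊆ M.E \ {e}, e ∉ M.closure A ∧ e ∉ M.closure ((M.E \ {e}) \ A)) →
    (¬ ∃ W ⊆ M.E, W.ncard ≤ 9 ∧ W.encard = M.eRk W + 4) → M.E.encard = M.eRank + j → ∀ m : ℕ, M.E.ncard = m →
    (∀ e, ¬ M.IsColoop e) → {C : Set α | M.IsCircuit C ∧ C.ncard = 6}.ncard ≤ gSix j m := by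
  induction j with
  | zero =>
    intro M _ hfree hns hd m hm hK
    have h := ncard_sixCircuits_le_capSum_qSixAll M hfree hns hd
    have h0 : capSum qSixAll 0 = 0 := by decide
    rw [h0] at h
    simpa [gSix] using h
  | succ j ih =>
    intro M _ hfree hns hd m hm hK
    have hnon : {C : Set α | M.IsCircuit C ∧ C.ncard = 6}.ncard ≤ bSix (j + 1) :=
      ncard_sixCircuits_le_capSum_qSixAll M hfree hns hd
    simp only [gSix]
    split_ifs with h4
    · exact hnon
    · refine le_min hnon ?_
      have hfloor := nullity_add_six_le_ncard_of_spread M hns hd (by omega)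
      rw [hm] at hfloor
      refine ncard_sixCircuits_le_max_of_series M hfree hns hd hm (by omega) hK ?_ ?_ ?_
      · intro M' _ hfree' hns' hd' hle hK'
        have hfl := nullity_add_six_le_ncard_of_spread M' hns' hd' (by omega)
        exact (ih M' hfree' hns' hd' _ rfl hK').trans (Finset.le_sup (f := gSix j) (Finset.mem_Icc.2 ⟨hfl, hle⟩))
      · intro M' _ hfree' hns' hd' hge hle hK'
        have hfl := nullity_add_six_le_ncard_of_spread M' hns' hd' (by omega)
        exact (ih M' hfree' hns' hd' _ rfl hK').trans
          (Finset.le_sup (f := gSix j) (Finset.mem_Icc.2 ⟨max_le hfl hge, hle⟩))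
      · intro M' _ hfree' hns' hd' hge hle hK'
        have hfl := nullity_add_six_le_ncard_of_spread M' hns' hd' (by omega)
        exact (ih M' hfree' hns' hd' _ rfl hK').trans
          (Finset.le_sup (f := gSix j) (Finset.mem_Icc.2 ⟨max_le hfl hge, hle⟩))

/-- The values of the `s₆` chain on the cells of the row `p = 13` and its coloop sub-cells. -/
theorem gSix_values :
    gSix 6 18 = 220 ∧ gSix 6 19 = 204 ∧ gSix 7 19 = 447 ∧ gSix 7 20 = 382 ∧ gSix 8 20 = 840 ∧ gSix 8 21 = 737 := by
  decide

/-- **THE `(13, 7)` SPREAD `s₆` CAP, SERIES-AWARE: `s₆ ≤ 382`** on `20` points at nullity `7` (the trivial cap is `924`). -/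
theorem ncard_sixCircuits_le_three_eighty_two_spread_twenty (M : Matroid α) [M.Finite]
    (hfree : ∀ e ∈ M.E, ∃ A ⊆ M.E \ {e}, e ∉ M.closure A ∧ e ∉ M.closure ((M.E \ {e}) \ A))
    (hns : ¬ ∃ W ⊆ M.E, W.ncard ≤ 9 ∧ W.encard = M.eRk W + 4) (hd : M.E.encard = M.eRank + 7)
    (hn : M.E.ncard = 20) (hK : ∀ e, ¬ M.IsColoop e) :
    {C : Set α | M.IsCircuit C ∧ C.ncard = 6}.ncard ≤ 382 := by
  have h := ncard_sixCircuits_le_gSix 7 M hfree hns hd 20 hn hK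
  rw [gSix_values.2.2.2.1] at h
  exact h

/-- **THE `(13, 8)` SPREAD `s₆` CAP, SERIES-AWARE: `s₆ ≤ 737`** on `21` points at nullity `8` (the trivial cap is `1716`). -/
theorem ncard_sixCircuits_le_seven_thirty_seven_spread_twenty_one (M : Matroid α) [M.Finite]
    (hfree : ∀ e ∈ M.E, ∃ A ⊆ M.E \ {e}, e ∉ M.closure A ∧ e ∉ M.closure ((M.E \ {e}) \ A))
    (hns : ¬ ∃ W ⊆ M.E, W.ncard ≤ 9 ∧ W.encard = M.eRk W + 4) (hd : M.E.encard = M.eRank + 8)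
    (hn : M.E.ncard = 21) (hK : ∀ e, ¬ M.IsColoop e) :
    {C : Set α | M.IsCircuit C ∧ C.ncard = 6}.ncard ≤ 737 := by
  have h := ncard_sixCircuits_le_gSix 8 M hfree hns hd 21 hn hK
  rw [gSix_values.2.2.2.2.2] at h
  exact h

/-- **THE `(13, 6)` SPREAD `s₆` CAP, SERIES-AWARE: `s₆ ≤ 204`** on `19` points at nullity `6` (the trivial cap is `462`). -/
theorem ncard_sixCircuits_le_two_o_four_spread_nineteen (M : Matroid α) [M.Finite]
    (hfree : ∀ e ∈ M.E, ∃ A ⊆ M.E \ {e}, e ∉ M.closure A ∧ e ∉ M.closure ((M.E \ {e}) \ A))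
    (hns : ¬ ∃ W ⊆ M.E, W.ncard ≤ 9 ∧ W.encard = M.eRk W + 4) (hd : M.E.encard = M.eRank + 6)
    (hn : M.E.ncard = 19) (hK : ∀ e, ¬ M.IsColoop e) :
    {C : Set α | M.IsCircuit C ∧ C.ncard = 6}.ncard ≤ 204 := by
  have h := ncard_sixCircuits_le_gSix 6 M hfree hns hd 19 hn hK
  rw [gSix_values.2.1] at h
  exact h

/-- **THE `(12, 7)` SPREAD `s₆` CAP, SERIES-AWARE: `s₆ ≤ 447`** on `19` points at nullity `7`. -/
theorem ncard_sixCircuits_le_four_forty_seven_spread_nineteen (M : Matroid α) [M.Finite]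
    (hfree : ∀ e ∈ M.E, ∃ A ⊆ M.E \ {e}, e ∉ M.closure A ∧ e ∉ M.closure ((M.E \ {e}) \ A))
    (hns : ¬ ∃ W ⊆ M.E, W.ncard ≤ 9 ∧ W.encard = M.eRk W + 4) (hd : M.E.encard = M.eRank + 7)
    (hn : M.E.ncard = 19) (hK : ∀ e, ¬ M.IsColoop e) :
    {C : Set α | M.IsCircuit C ∧ C.ncard = 6}.ncard ≤ 447 := by
  have h := ncard_sixCircuits_le_gSix 7 M hfree hns hd 19 hn hK
  rw [gSix_values.2.2.1] at h
  exact h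

/-- **THE `(12, 8)` SPREAD `s₆` CAP, SERIES-AWARE: `s₆ ≤ 840`** on `20` points at nullity `8`. -/
theorem ncard_sixCircuits_le_eight_forty_spread_twenty (M : Matroid α) [M.Finite]
    (hfree : ∀ e ∈ M.E, ∃ A ⊆ M.E \ {e}, e ∉ M.closure A ∧ e ∉ M.closure ((M.E \ {e}) \ A))
    (hns : ¬ ∃ W ⊆ M.E, W.ncard ≤ 9 ∧ W.encard = M.eRk W + 4) (hd : M.E.encard = M.eRank + 8)
    (hn : M.E.ncard = 20) (hK : ∀ e, ¬ M.IsColoop e) :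
    {C : Set α | M.IsCircuit C ∧ C.ncard = 6}.ncard ≤ 840 := by
  have h := ncard_sixCircuits_le_gSix 8 M hfree hns hd 20 hn hK
  rw [gSix_values.2.2.2.2.1] at h
  exact h

/-- **THE `(12, 6)` SPREAD `s₆` CAP, SERIES-AWARE: `s₆ ≤ 220`** on `18` points at nullity `6`. -/
theorem ncard_sixCircuits_le_two_twenty_spread_eighteen (M : Matroid α) [M.Finite]
    (hfree : ∀ e ∈ M.E, ∃ A ⊆ M.E \ {e}, e ∉ M.closure A ∧ e ∉ M.closure ((M.E \ {e}) \ A))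
    (hns : ¬ ∃ W ⊆ M.E, W.ncard ≤ 9 ∧ W.encard = M.eRk W + 4) (hd : M.E.encard = M.eRank + 6)
    (hn : M.E.ncard = 18) (hK : ∀ e, ¬ M.IsColoop e) :
    {C : Set α | M.IsCircuit C ∧ C.ncard = 6}.ncard ≤ 220 := by
  have h := ncard_sixCircuits_le_gSix 6 M hfree hns hd 18 hn hK
  rw [gSix_values.1] at h
  exact h

end S1

end PercRepro
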